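import Summits.NavierStokesRegularity.NavierStokesRegularity.Theorems.LerayQuarterDissipationFiniteDissipationLiouvilleQuietSlice
import Literature.Analysis.FluidPDE.NSLerayBlowupRateLpProofs
import HarnessLib

/-!
# Crux `FiniteDissipationLiouville` (stmt-NavierStokesRegularity-22144): the quiet-slice leaf with
# an ABSOLUTE threshold — one instant of dimensionless dissipation `≤ δ₀` forbids the singularity,
# `δ₀` independent of `C` and `K`

Theorems file of route `LerayQuarterDissipation` (seat ns-lqd-p2 g7; `--supports` the crux).
Navier–Stokes regularity is NOT proved by anything here; no summit is.

The quiet-slice leaf `QuietSlice.quietSlice_leaf` (p606065) gives, for every stratum `𝒟_{C,K}`, a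
threshold `δ(C,K) > 0` by compactness. This file makes the threshold ABSOLUTE and the mechanism
QUANTITATIVE, by Leray's sup-norm Volterra inequality run forward from the quiet slice inside the
class (the `L⁶` case of Leray 1934 §22 / Giga 1986: `L⁶` data of size `N` control the sup norm by
`2N (t − t₀)^{-1/4}` on a time window `≳ N^{-4}`; for `N` below an absolute threshold the window
reaches past the apex):

* `bound_of_small_lsix_slice` — there is an ABSOLUTE `ε > 0` (namely `(64 κ)⁻¹`, `κ` the Oseen
  slice constant `oseenSliceConst`) such that every Type-I ancient mild field `w` (KNSS gauge, ANY
  constant `C`) whose slice `w(−1)` lies in `L⁶` with `‖w(−1)‖₆ ≤ ε` obeys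
  `‖w(t, y)‖ ≤ 2ε (t+1)^{-1/4}` for all `−1 < t < 0` — in particular it is bounded up to the apex.
  Proof: the Oseen identity from `s = −1` (`mild_eq_heatExtension`), the heat bound
  `|e^{τΔ}g| ≤ τ^{-1/4}‖g‖₆` (`Birth.norm_heatExtension_le_rpow_mul_lsix`) and the pointwise Duhamel
  bound with time-dependent slice majorants (`norm_oseenDuhamel_le_setIntegral`) give Leray's
  inequality `V(s) ≤ ε s^{-1/4} + κ ∫₀ˢ (s−τ)^{-1/2} V(τ)² dτ` for the (measurable, lower
  semicontinuous) sup norm `V` of the translated field, and the tree's comparison principle on the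
  `L⁶` window (`volterra_window_bound`, Ożański–Pooley 2018 Lemma 6.23 (iii) / Leray 1934 §21) —
  whose window is `≥ 1` exactly when `‖w(−1)‖₆ ≤ (64κ)⁻¹` — bounds `V`;
* `quietSlice_leaf_absolute` — **there is an ABSOLUTE `δ₀ > 0` such that for ALL `C, K`, a member
  of `𝒟_{C,K}` with ONE instant `t < 0` of dissipation `∫ ‖∇w(t)‖² ≤ δ₀/√(−t)` is bounded on a
  backward cylinder at the origin** (scale the instant to `−1`; Sobolev modulo constants
  `Birth.exists_const_sub_lsix_le` with the gauge killing the constant — `Birth.memLp_six_slice` and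
  `|ℝ³| = ∞` — turns the quiet dissipation into `‖w(−1)‖₆ ≤ C_S √δ₀ = ε`);
* `dissipation_floor_absolute` — contrapositive: **every singular member of every stratum
  dissipates more than `δ₀/√(−t)` at every instant**, `δ₀` absolute (`= (ε/C_S)²`).

HONEST FRAMING. "Absolute" = independent of `C`, `K` and the profile; the constant is explicit in
terms of the tree's two existential absolute constants `oseenSliceConst` and the Sobolev-modulo-
constants level `C_S` of `exists_const_sub_lsix_le`. The statement removes from the wall of the
crux every profile with one quiet instant; it does not touch the wall (`∀ c>1, TypeIDSSLiouville c`).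

References: J. Leray, Acta Math. 63 (1934), §21 (3.5), (3.14)–(3.16), §22; W. S. Ożański,
B. C. Pooley, LMS Lecture Note Ser. 452 (2018), Lemma 6.23 (iii), Cor. 6.24–6.25; Y. Giga,
J. Differential Equations 62 (1986), Thm. 4; Koch–Nadirashvili–Seregin–Šverák, Acta Math. 203
(2009), §4.
-/

noncomputable section

-- the summit and its single sub-problem share the name (CONVENTIONS §1), as in every Theorems file
set_option linter.dupNamespace false

namespace Summit.NavierStokesRegularity.NavierStokesRegularity.Theorems.FiniteDissipationLiouville.QuietSliceAbsolute

open MeasureTheory Set Filter Topology Metric Function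
open Literature.Analysis Literature.Analysis.FluidPDE Literature.Analysis.UnboundedOperators
open Summit.NavierStokesRegularity.NavierStokesRegularity.Theorems.FiniteDissipationLiouville
open scoped ENNReal NNReal

/-! ### Leray's sup-norm bound from a small `L⁶` slice, inside the class -/

/-- **Small `L⁶` slice ⇒ sup-norm bound up to the apex, absolute threshold.** There is an absolute
`ε > 0` such that every Type-I ancient mild field `w` (any constant `C`) with `w(−1) ∈ L⁶`,
`‖w(−1)‖₆ ≤ ε`, satisfies `‖w(t,y)‖ ≤ 2ε (t+1)^{-1/4}` for `−1 < t < 0` (Leray's Volterra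
inequality for the sup norm of `s ↦ w(s−1)` from the Oseen identity, the `L⁶ → L^∞` heat bound and
the pointwise Duhamel bound; comparison with `2ε s^{-1/4}` on the `L⁶` window, which covers `(0,1]`
when `ε = (64 κ)⁻¹`). [cite: OzanskiPooley2018, Lemma 6.23 (iii) with (6.65), pp. 143–144] [cite: Leray1934, §21 (3.5), (3.14)–(3.16); §22] -/
theorem bound_of_small_lsix_slice : ∃ ε > 0, ∀ (C : ℝ)
    (w : ℝ → EuclideanSpace ℝ (Fin 3) → EuclideanSpace ℝ (Fin 3)),
    IsTypeIAncientMild C w → MemLp (w (-1)) 6 volume →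
    (∫ y, ‖w (-1) y‖ ^ (6 : ℝ)) ^ (1 / 6 : ℝ) ≤ ε →
    ∀ t ∈ Ioo (-1 : ℝ) 0, ∀ y, ‖w t y‖ ≤ 2 * ε * (t + 1) ^ (-(1 / 4 : ℝ)) := by
  set κ : ℝ := oseenSliceConst (EuclideanSpace ℝ (Fin 3)) with hκ
  have hκpos : 0 < κ := oseenSliceConst_pos
  set ε : ℝ := (64 * κ)⁻¹ with hε
  have hεpos : 0 < ε := by rw [hε]; positivity
  refine ⟨ε, hεpos, fun C w hw h6 hN t ht y => ?_⟩
  have hC : 0 ≤ C := hw.nonneg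
  -- ## the translated field `u σ = w (σ − 1)` on the closed window `[0, T₁]`, `T₁ = t + 1`
  set T₁ : ℝ := t + 1 with hT₁
  have hT₁pos : 0 < T₁ := by rw [hT₁]; linarith [ht.1]
  have hT₁le : T₁ < 1 := by rw [hT₁]; linarith [ht.2]
  set u : ℝ → EuclideanSpace ℝ (Fin 3) → EuclideanSpace ℝ (Fin 3) := fun σ => w (σ - 1) with hu
  -- pointwise bound `M` on the window (Type I away from the apex)
  set M : ℝ := max (C / Real.sqrt (-t)) 1 with hM
  have hMpos : 0 < M := lt_of_lt_of_le one_pos (le_max_right _ _)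
  have hMb : ∀ σ ∈ Icc 0 T₁, ∀ z, ‖u σ z‖ ≤ M := by
    intro σ hσ z
    have hσ1 : σ - 1 < 0 := by rw [hT₁] at hσ; linarith [hσ.2, ht.2]
    refine (hw.norm_le hσ1 z).trans ((div_le_div_of_nonneg_left hC (Real.sqrt_pos.2 (neg_pos.2 ht.2))
      (Real.sqrt_le_sqrt (by rw [hT₁] at hσ; linarith [hσ.2]))).trans (le_max_left _ _))
  -- ## the clamped sup norm `V`
  obtain ⟨cl, hcl_def⟩ : ∃ cl : ℝ → ℝ, cl = fun τ => max 0 (min τ T₁) := ⟨_, rfl⟩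
  have hcl_mem : ∀ τ, cl τ ∈ Icc 0 T₁ := fun τ => by
    rw [hcl_def]
    exact ⟨le_max_left _ _, max_le hT₁pos.le (min_le_right _ _)⟩
  have hcl_id : ∀ τ ∈ Icc 0 T₁, cl τ = τ := fun τ hτ => by
    rw [hcl_def]
    show max 0 (min τ T₁) = τ
    rw [min_eq_left hτ.2, max_eq_right hτ.1]
  have hcl_cont : Continuous cl := by
    rw [hcl_def]
    exact continuous_const.max (continuous_id.min continuous_const)
  obtain ⟨V, hV⟩ : ∃ V : ℝ → ℝ, V = fun τ => ⨆ z, ‖u (cl τ) z‖ := ⟨_, rfl⟩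
  have hbddV : ∀ τ, BddAbove (range fun z => ‖u (cl τ) z‖) := fun τ =>
    ⟨M, forall_mem_range.2 fun z => hMb _ (hcl_mem τ) z⟩
  have hVle : ∀ τ z, ‖u (cl τ) z‖ ≤ V τ := fun τ z => by
    rw [hV]
    exact le_ciSup (hbddV τ) z
  have hV0 : ∀ τ, 0 ≤ V τ := fun τ => (norm_nonneg _).trans (hVle τ 0)
  have hVM : ∀ τ, V τ ≤ M := fun τ => by
    rw [hV]
    exact ciSup_le fun z => hMb _ (hcl_mem τ) z
  have hVu : ∀ τ ∈ Icc 0 T₁, ∀ z, ‖u τ z‖ ≤ V τ := fun τ hτ z => by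
    have h := hVle τ z
    rwa [hcl_id τ hτ] at h
  have hVm : Measurable V := by
    have hcont : ContinuousOn (uncurry w) (Iio 0 ×ˢ univ) := hw.continuousOn_uncurry
    have hcy : ∀ z : EuclideanSpace ℝ (Fin 3), Continuous fun τ : ℝ => ‖u (cl τ) z‖ := fun z => by
      have h1 : Continuous fun τ : ℝ => (cl τ - 1, z) :=
        (hcl_cont.sub continuous_const).prodMk continuous_const
      have h2 : ∀ τ, (cl τ - 1, z) ∈ Iio (0 : ℝ) ×ˢ (univ : Set (EuclideanSpace ℝ (Fin 3))) :=
        fun τ => ⟨by have := (hcl_mem τ).2; show cl τ - 1 < 0; linarith, mem_univ _⟩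
      exact (hcont.comp_continuous h1 h2).norm
    rw [hV]
    exact (lowerSemicontinuous_ciSup
      (f := fun (z : EuclideanSpace ℝ (Fin 3)) (τ : ℝ) => ‖u (cl τ) z‖) hbddV
      fun z => (hcy z).lowerSemicontinuous).measurable
  -- ## Leray's integral inequality for `V` on `(0, T₁]`
  have hN0 : 0 ≤ (∫ z, ‖w (-1) z‖ ^ (6 : ℝ)) ^ (1 / 6 : ℝ) :=
    Real.rpow_nonneg (integral_nonneg fun z => by positivity) _
  have hVolt : ∀ s ∈ Ioc 0 T₁, V s ≤ ε * (1 * s) ^ (-(3 / (2 * 6) : ℝ)) +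
      κ * (1 : ℝ) ^ (-(1 / 2 : ℝ)) * ∫ τ in Ioo 0 s, (s - τ) ^ (-(1 / 2 : ℝ)) * V τ ^ 2 := by
    intro s hs
    have hs0 : 0 < s := hs.1
    have hsI : s ∈ Icc 0 T₁ := ⟨hs.1.le, hs.2⟩
    have hs1 : s - 1 < 0 := by linarith [hs.2]
    -- the memory integrand is integrable
    have hkern : IntegrableOn (fun τ => (s - τ) ^ (-(1 / 2 : ℝ)) * (V τ * V τ)) (Ioo 0 s) := by
      refine Integrable.mul_bdd (c := M * M) (integrableOn_sub_rpow_Ioo (by norm_num))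
        ((hVm.mul hVm).aestronglyMeasurable) (Eventually.of_forall fun τ => ?_)
      rw [Real.norm_of_nonneg (mul_nonneg (hV0 τ) (hV0 τ))]
      exact mul_le_mul (hVM τ) (hVM τ) (hV0 τ) hMpos.le
    have hI0 : 0 ≤ ∫ τ in Ioo 0 s, (s - τ) ^ (-(1 / 2 : ℝ)) * V τ ^ 2 :=
      setIntegral_nonneg measurableSet_Ioo fun τ hτ =>
        mul_nonneg (Real.rpow_nonneg (sub_nonneg.2 hτ.2.le) _) (sq_nonneg _)
    -- pointwise bound at time `s`
    have hpt : ∀ z, ‖u s z‖ ≤ ε * s ^ (-(1 / 4 : ℝ)) +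
        κ * ∫ τ in Ioo 0 s, (s - τ) ^ (-(1 / 2 : ℝ)) * V τ ^ 2 := by
      intro z
      -- Oseen identity from the slice `−1`
      have hmild : w (s - 1) z = heatExtension (w (-1)) s z - oseenDuhamel 1 (-1) w w (s - 1) z := by
        have h := hw.mild_eq_heatExtension (s := -1) (t := s - 1) (by linarith) hs1 z
        rwa [show s - 1 - (-1 : ℝ) = s by ring] at h
      -- the heat term
      have hheat : ‖heatExtension (w (-1)) s z‖ ≤ ε * s ^ (-(1 / 4 : ℝ)) := by
        refine (Birth.norm_heatExtension_le_rpow_mul_lsix h6 hs0 z).trans ?_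
        rw [mul_comm]
        exact mul_le_mul_of_nonneg_right hN (Real.rpow_nonneg hs0.le _)
      -- the Duhamel term, moved to initial time `0` for `u`
      have hshift : oseenDuhamel 1 (-1) w w (s - 1) z = oseenDuhamel 1 0 u u s z := by
        have h := oseenDuhamel_comp_sub_right 1 0 s 1 w w z
        rw [show (0 : ℝ) - 1 = -1 by ring] at h
        rw [hu]
        exact h.symm
      have hVu' : ∀ τ ∈ Ioo 0 s, ∀ z', ‖u τ z'‖ ≤ V τ := fun τ hτ z' =>
        hVu τ ⟨hτ.1.le, hτ.2.le.trans hs.2⟩ z'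
      have hduh : ‖oseenDuhamel 1 0 u u s z‖ ≤
          κ * ∫ τ in Ioo 0 s, (s - τ) ^ (-(1 / 2 : ℝ)) * V τ ^ 2 := by
        have h := norm_oseenDuhamel_le_setIntegral hVu' hVu' hkern z
        have e : (fun τ => (s - τ) ^ (-(1 / 2 : ℝ)) * (V τ * V τ)) =
            fun τ => (s - τ) ^ (-(1 / 2 : ℝ)) * V τ ^ 2 := funext fun τ => by rw [sq]
        rw [e] at h
        exact h
      calc ‖u s z‖ = ‖w (s - 1) z‖ := by rw [hu]
        _ = ‖heatExtension (w (-1)) s z - oseenDuhamel 1 0 u u s z‖ := by rw [hmild, hshift]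
        _ ≤ ‖heatExtension (w (-1)) s z‖ + ‖oseenDuhamel 1 0 u u s z‖ := norm_sub_le _ _
        _ ≤ _ := add_le_add hheat hduh
    have hVs : V s = ⨆ z, ‖u s z‖ := by
      rw [hV]
      show (⨆ z, ‖u (cl s) z‖) = ⨆ z, ‖u s z‖
      rw [hcl_id s hsI]
    rw [hVs]
    have hconv : ε * s ^ (-(1 / 4 : ℝ)) + κ * ∫ τ in Ioo 0 s, (s - τ) ^ (-(1 / 2 : ℝ)) * V τ ^ 2 =
        ε * (1 * s) ^ (-(3 / (2 * 6) : ℝ)) +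
          κ * (1 : ℝ) ^ (-(1 / 2 : ℝ)) * ∫ τ in Ioo 0 s, (s - τ) ^ (-(1 / 2 : ℝ)) * V τ ^ 2 := by
      rw [one_mul, Real.one_rpow, mul_one]
      norm_num
    rw [← hconv]
    exact ciSup_le hpt
  -- ## the `L⁶` window covers `(0, 1]` exactly for `ε = (64κ)⁻¹`
  have htw : T₁ ≤ (8 * κ * (2 * (2 + 1 / (1 - 2 * (3 / (2 * 6)))))) ^ (-(2 * 6 / (6 - 3) : ℝ)) *
      (1 : ℝ) ^ ((6 + 3) / (6 - 3) : ℝ) * ε ^ (-(2 * 6 / (6 - 3) : ℝ)) := by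
    have h64 : (8 * κ * (2 * (2 + 1 / (1 - 2 * (3 / (2 * 6))))) : ℝ) = 64 * κ := by norm_num; ring
    have hexp : (-(2 * 6 / (6 - 3) : ℝ)) = -4 := by norm_num
    rw [h64, hexp, Real.one_rpow, mul_one, hε, Real.inv_rpow (by positivity),
      Real.rpow_neg (by positivity), mul_inv_cancel₀ (ne_of_gt (by positivity))]
    exact hT₁le.le
  -- ## the comparison on the window
  have hwin := volterra_window_bound (r := 6) hκpos one_pos hεpos hMpos (by norm_num) hT₁pos
    hVm hV0 hVM hVolt htw
  have hT₁I : T₁ ∈ Icc 0 T₁ := ⟨hT₁pos.le, le_rfl⟩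
  have h1 : ‖u T₁ y‖ ≤ V T₁ := hVu T₁ hT₁I y
  have e : u T₁ y = w t y := by rw [hu, hT₁]; simp
  rw [e] at h1
  refine h1.trans (hwin.trans (le_of_eq ?_))
  rw [one_mul, hT₁]
  norm_num

/-! ### The quiet-slice leaf with an absolute threshold -/

/-- **Quiet-slice leaf, absolute threshold.** There is an ABSOLUTE `δ₀ > 0` such that for all
`C, K` every member `w` of `𝒟_{C,K}` (Type-I ancient mild field in the KNSS gauge with the
quarter-rate dissipation law) having ONE instant `t < 0` with `∫ ‖∇w(t)‖² ≤ δ₀/√(−t)` is bounded on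
some backward cylinder `(−r², 0) × B(0, r)`: scale the instant to `−1`; Sobolev modulo constants
with the gauge killing the constant gives `‖w(−1)‖₆ ≤ C_S √δ₀ = ε`; `bound_of_small_lsix_slice`.
[cite: Leray1934, §21–§22] [cite: KochNadirashviliSereginSverak2009, §4 (arXiv:0709.3599 p. 8)] -/
theorem quietSlice_leaf_absolute : ∃ δ₀ > 0, ∀ (C K : ℝ)
    (w : ℝ → EuclideanSpace ℝ (Fin 3) → EuclideanSpace ℝ (Fin 3)),
      IsTypeIAncientMild C w →
      (∀ s : ℝ, s < 0 → ∫⁻ x, ‖fderiv ℝ (w s) x‖ₑ ^ 2 ≤ ENNReal.ofReal (K / Real.sqrt (-s))) →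
      (∃ t < 0, ∫⁻ x, ‖fderiv ℝ (w t) x‖ₑ ^ 2 ≤ ENNReal.ofReal (δ₀ / Real.sqrt (-t))) →
      ¬ (∀ r > 0, ∀ M : ℝ, ∃ t ∈ Ioo (-(r ^ 2)) (0 : ℝ),
        ∃ x ∈ ball (0 : EuclideanSpace ℝ (Fin 3)) r, M < ‖w t x‖) := by
  obtain ⟨ε, hε, hbound⟩ := bound_of_small_lsix_slice
  obtain ⟨CS, hCS, hsob⟩ := Birth.exists_const_sub_lsix_le
  obtain ⟨CL, -, hL6⟩ := Birth.memLp_six_slice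
  set δ₀ : ℝ := (ε / CS) ^ 2 with hδ₀
  have hδ₀pos : 0 < δ₀ := by rw [hδ₀]; positivity
  refine ⟨δ₀, hδ₀pos, ?_⟩
  intro C K w hw hlaw ⟨t₀, ht₀, hq⟩ hsing
  have hC : 0 ≤ C := hw.nonneg
  -- ## scale the quiet instant to `−1`
  set c : ℝ := Real.sqrt (-t₀) with hc_def
  have hc : 0 < c := Real.sqrt_pos.2 (neg_pos.2 ht₀)
  set v : ℝ → EuclideanSpace ℝ (Fin 3) → EuclideanSpace ℝ (Fin 3) := nsRescale c w with hv_def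
  have hv : IsTypeIAncientMild C v := isTypeIAncientMild_nsRescale hw hc
  have hvlaw : ∀ s : ℝ, s < 0 →
      ∫⁻ x, ‖fderiv ℝ (v s) x‖ₑ ^ 2 ≤ ENNReal.ofReal (K / Real.sqrt (-s)) :=
    RecurrentReductionD.dissipationLaw_nsRescale hlaw hc
  have hvsing : ∀ r > 0, ∀ M : ℝ, ∃ t ∈ Ioo (-(r ^ 2)) (0 : ℝ),
      ∃ x ∈ ball (0 : EuclideanSpace ℝ (Fin 3)) r, M < ‖v t x‖ :=
    RecurrentReductionD.singularAtOrigin_nsRescale hsing hc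
  have hvquiet : ∫⁻ x, ‖fderiv ℝ (v (-1)) x‖ₑ ^ 2 ≤ ENNReal.ofReal δ₀ := by
    have e : c ^ 2 * (-1 : ℝ) = t₀ := by
      rw [hc_def, Real.sq_sqrt (neg_nonneg.2 ht₀.le)]; ring
    have hq' : ∫⁻ x, ‖fderiv ℝ (w (c ^ 2 * (-1))) x‖ₑ ^ 2 ≤
        ENNReal.ofReal (δ₀ / Real.sqrt (-(c ^ 2 * (-1)))) := by
      rw [e]; exact hq
    have h1 := Subthreshold.law_nsRescale_of_law_at hc (by norm_num : (-1 : ℝ) < 0) hq'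
    simpa using h1
  -- ## the slice `v(−1)` is small in `L⁶`: Sobolev modulo constants, the gauge kills the constant
  have h1 : (-1 : ℝ) < 0 := by norm_num
  have hf1 : ContDiff ℝ 1 (v (-1)) := (hv.contDiff_slice h1).of_le (by exact_mod_cast le_top)
  obtain ⟨k, -, hmemk, hNk⟩ := hsob (v (-1)) hf1 (C / Real.sqrt (-(-1 : ℝ)))
    (fun y => hv.norm_le h1 y) δ₀ hδ₀pos.le hvquiet
  have hmem : MemLp (v (-1)) 6 volume := (hL6 C K v hv hvlaw (-1) h1).1
  have hk0 : k = 0 := by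
    have hconst : MemLp (fun _ : EuclideanSpace ℝ (Fin 3) => k) 6 volume := by
      have h := hmem.sub hmemk
      have e : (v (-1)) - (fun y => v (-1) y - k) = fun _ => k := by
        funext y; simp
      rw [e] at h
      exact h
    rcases (memLp_const_iff (by norm_num) (by norm_num)).1 hconst with h | h
    · exact h
    · have huniv : (volume : Measure (EuclideanSpace ℝ (Fin 3))) univ = ∞ :=
        measure_univ_of_isAddLeftInvariant _
      rw [huniv] at h
      exact absurd h (lt_irrefl _)
  have hN : (∫ y, ‖v (-1) y‖ ^ (6 : ℝ)) ^ (1 / 6 : ℝ) ≤ ε := by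
    have h := hNk
    simp only [hk0, sub_zero] at h
    refine h.trans ?_
    rw [hδ₀, Real.sqrt_sq (by positivity), mul_div_cancel₀ _ hCS.ne']
  -- ## the sup-norm bound up to the apex, contradicting the singular clause
  have hb := hbound C v hv hmem hN
  -- the cylinder of radius `1/2` and the bound `4ε`
  obtain ⟨t, ht, x, -, hbig⟩ := hvsing (1 / 2) (by norm_num) (4 * ε)
  have htI : t ∈ Ioo (-1 : ℝ) 0 := ⟨by linarith [ht.1], ht.2⟩
  have hbt := hb t htI x
  have hpow : (t + 1) ^ (-(1 / 4 : ℝ)) ≤ 2 := by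
    have ht1 : (1 / 2 : ℝ) ≤ t + 1 := by nlinarith [ht.1]
    calc (t + 1) ^ (-(1 / 4 : ℝ)) ≤ (1 / 2 : ℝ) ^ (-(1 / 4 : ℝ)) :=
          Real.rpow_le_rpow_of_nonpos (by norm_num) ht1 (by norm_num)
      _ ≤ (1 / 2 : ℝ) ^ (-(1 : ℝ)) := by
          refine Real.rpow_le_rpow_of_exponent_ge (by norm_num) (by norm_num) (by norm_num)
      _ = 2 := by norm_num
  have : ‖v t x‖ ≤ 4 * ε := by
    calc ‖v t x‖ ≤ 2 * ε * (t + 1) ^ (-(1 / 4 : ℝ)) := hbt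
      _ ≤ 2 * ε * 2 := mul_le_mul_of_nonneg_left hpow (by positivity)
      _ = 4 * ε := by ring
  linarith

/-- **Absolute instantaneous dissipation floor of a finite-dissipation Type-I singularity.**
There is an ABSOLUTE `δ₀ > 0` such that for all `C, K` every member of `𝒟_{C,K}` which is singular
at the apex has `δ₀/√(−t) < ∫ ‖∇w(t)‖²` at EVERY instant `t < 0` (contrapositive of
`quietSlice_leaf_absolute`). [cite: Leray1934, §22] [cite: KochNadirashviliSereginSverak2009, §4 (arXiv:0709.3599 p. 8)] -/
theorem dissipation_floor_absolute : ∃ δ₀ > 0, ∀ (C K : ℝ)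
    (w : ℝ → EuclideanSpace ℝ (Fin 3) → EuclideanSpace ℝ (Fin 3)),
      IsTypeIAncientMild C w →
      (∀ s : ℝ, s < 0 → ∫⁻ x, ‖fderiv ℝ (w s) x‖ₑ ^ 2 ≤ ENNReal.ofReal (K / Real.sqrt (-s))) →
      (∀ r > 0, ∀ M : ℝ, ∃ t ∈ Ioo (-(r ^ 2)) (0 : ℝ),
        ∃ x ∈ ball (0 : EuclideanSpace ℝ (Fin 3)) r, M < ‖w t x‖) →
      ∀ t < 0, ENNReal.ofReal (δ₀ / Real.sqrt (-t)) < ∫⁻ x, ‖fderiv ℝ (w t) x‖ₑ ^ 2 := by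
  obtain ⟨δ₀, hδ₀, h⟩ := quietSlice_leaf_absolute
  refine ⟨δ₀, hδ₀, fun C K w hw hlaw hsing t ht => ?_⟩
  by_contra hle
  push Not at hle
  exact h C K w hw hlaw ⟨t, ht, hle⟩ hsing

end Summit.NavierStokesRegularity.NavierStokesRegularity.Theorems.FiniteDissipationLiouville.QuietSliceAbsolute

end
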